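import Summits.NavierStokesRegularity.NavierStokesRegularity.Theorems.TypeICertificateLadderRungReynoldsOneTaoCover
import Literature.Analysis.FluidPDE.NSLerayBlowupRateEnstrophy
import Literature.Analysis.FluidPDE.TaoEnstrophyLocalisationProofs
import Summits.NavierStokesRegularity.NavierStokesRegularity.Theses.EfficiencyFloor
import HarnessLib

/-!
# `EfficiencyFloor.BlowupEnstrophyUnbounded` (item stmt-NavierStokesRegularity-22867): blow-up forces
# the enstrophy to diverge

**Statement (the route decl, verbatim).** For a maximal smooth solution `(u,p)` of the unforced
Navier–Stokes system on `ℝ³ × [0,T)` (`ν, T > 0`; classical, no smooth extension past `T`),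
Leray–Hopf from a rapidly decaying datum: for every `N`, eventually as `t ↑ T`,
`N ≤ Z(t) = ∫|curl u(t)|²` (lower Lebesgue integral).

PROOF. Leray's enstrophy floor `c ν^{3/2} (T−t)^{−1/2} ≤ ∫|∇u(t)|²_F` on `[0,T)`
(`Literature.Analysis.FluidPDE.leray_blowup_rate_enstrophy`, Robinson–Rodrigo–Sadowski Lemma 6.13),
whose sub-slab boundedness hypothesis `u ∈ L^∞([0,T'] × ℝ³)` follows from the Tao-class cover of
closed sub-slabs (`RungReynoldsOne.stub_taoCover` + `exists_forall_norm_le_of_hasBoundedSobolevNormsOn`);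
then `∫|∇u|²_F ≤ ∫|curl u|²` (`lintegral_frobeniusNormSq_fderiv_le_lintegral_sq_norm_curl`) and
`c ν^{3/2}(T−t)^{−1/2} ≥ N` on the window `T − t < (cν^{3/2}/N)²`.

HONEST FRAMING: a statement about a HYPOTHETICAL maximal solution of finite lifespan; nothing here
asserts that one exists, and nothing about NS regularity is claimed. [folklore]
-/

noncomputable section

open Set Filter Topology MeasureTheory Function
open scoped ENNReal NNReal
open Literature.Analysis.FluidPDE

namespace Summit.NavierStokesRegularity.NavierStokesRegularity.Theorems

-- the problem directory repeats the summit name (`NavierStokesRegularity/NavierStokesRegularity`)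
set_option linter.dupNamespace false

namespace BlowupEnstrophyUnbounded

open Summit.NavierStokesRegularity.NavierStokesRegularity.Theorems.RungReynoldsOne

/-- Sub-slab boundedness in the `L^∞` form consumed by `leray_blowup_rate_enstrophy`: a classical
Leray–Hopf rapidly-decaying-datum solution on `[0,T)` is essentially bounded on `[0,T'] × ℝ³` for
every `T' < T`. [cite: Tao2011, Cor. 11.1 + Thm. 5.4 (iv)] -/
theorem eLpNorm_uncurry_top_lt_top {ν T : ℝ} (hν : 0 < ν) (hT : 0 < T)
    {u : ℝ → EuclideanSpace ℝ (Fin 3) → EuclideanSpace ℝ (Fin 3)}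
    {p : ℝ → EuclideanSpace ℝ (Fin 3) → ℝ}
    (hsol : IsClassicalNSSolutionOn (Ico 0 T) ν 0 u p) (hLH : IsLerayHopfOn T ν 0 (u 0) u)
    (hdec : HasRapidSpatialDecay (u 0)) :
    ∀ T' ∈ Ioo 0 T, eLpNorm (uncurry u) ∞ (volume.restrict (Icc 0 T' ×ˢ univ)) < ∞ := by
  intro T' hT'
  obtain ⟨q, hsol', hu', -, -⟩ := stub_taoCover hν hT hsol hLH hdec hT'
  obtain ⟨B, -, hB⟩ := exists_forall_norm_le_of_hasBoundedSobolevNormsOn hsol' hu'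
  rw [eLpNorm_exponent_top]
  refine eLpNormEssSup_lt_top_of_ae_bound (C := B)
    (ae_restrict_of_forall_mem (measurableSet_Icc.prod MeasurableSet.univ) ?_)
  rintro ⟨t, x⟩ ⟨ht, -⟩
  exact hB t ht x

/-- **Blow-up forces the enstrophy to diverge** (the item's content). [folklore] -/
theorem main {ν T : ℝ} (hν : 0 < ν) (hT : 0 < T)
    {u : ℝ → EuclideanSpace ℝ (Fin 3) → EuclideanSpace ℝ (Fin 3)}
    {p : ℝ → EuclideanSpace ℝ (Fin 3) → ℝ}
    (hmax : IsMaximalSmoothSolution ν 0 u p T) (hLH : IsLerayHopfOn T ν 0 (u 0) u)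
    (hdec : HasRapidSpatialDecay (u 0)) (N : ℝ) :
    ∀ᶠ t in 𝓝[<] T, ENNReal.ofReal N ≤ ∫⁻ x, ‖curl (u t) x‖ₑ ^ 2 := by
  have hsol := hmax.isClassicalNSSolutionOn
  obtain ⟨c, hc, hrate⟩ := leray_blowup_rate_enstrophy
  have hfloor := hrate ν T hν hT u p hmax hLH (eLpNorm_uncurry_top_lt_top hν hT hsol hLH hdec)
  -- comparison `∫|∇u|²_F ≤ ∫|curl u|²` at every time
  have hcurl : ∀ t ∈ Ico 0 T, ∫⁻ x, ENNReal.ofReal (frobeniusNormSq (fderiv ℝ (u t) x)) ≤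
      ∫⁻ x, ‖curl (u t) x‖ₑ ^ 2 := by
    intro t ht
    have hL2 : ∫⁻ x, ‖u t x‖ₑ ^ 2 < ⊤ :=
      (hLH.lintegral_enorm_sq_le hν.le ⟨ht.1, ht.2.le⟩).trans_lt ENNReal.ofReal_lt_top
    exact lintegral_frobeniusNormSq_fderiv_le_lintegral_sq_norm_curl
      ((hsol.contDiff_velocity ht).of_le (by norm_cast)) (hsol.divFree t ht) hL2
  by_cases hN : N ≤ 0
  · exact Eventually.of_forall fun t => by rw [ENNReal.ofReal_of_nonpos hN]; exact bot_le
  rw [not_le] at hN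
  set A : ℝ := c * ν ^ (3 / 2 : ℝ) with hA
  have hApos : 0 < A := by positivity
  set δ : ℝ := (A / N) ^ 2 with hδ
  have hδpos : 0 < δ := by positivity
  have hwin : ∀ᶠ t in 𝓝[<] T, t ∈ Ioo (T - δ) T := Ioo_mem_nhdsLT (by linarith)
  have hIco : ∀ᶠ t in 𝓝[<] T, t ∈ Ico 0 T := Ico_mem_nhdsLT hT
  filter_upwards [hwin, hIco] with t ht htI
  have hTt : 0 < T - t := sub_pos.2 htI.2
  have hsq : 0 < Real.sqrt (T - t) := Real.sqrt_pos.2 hTt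
  -- `N ≤ A (T−t)^{−1/2}` on the window
  have hlt : Real.sqrt (T - t) < A / N := by
    rw [show A / N = Real.sqrt δ by rw [hδ, Real.sqrt_sq (div_pos hApos hN).le]]
    exact Real.sqrt_lt_sqrt hTt.le (by linarith [ht.1])
  have h1 : N ≤ A * (T - t) ^ (-(1 / 2 : ℝ)) := by
    rw [Real.rpow_neg hTt.le, ← Real.sqrt_eq_rpow, ← div_eq_mul_inv, le_div_iff₀ hsq]
    have h2 := mul_lt_mul_of_pos_left hlt hN
    rw [mul_div_cancel₀ _ hN.ne'] at h2
    linarith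
  calc ENNReal.ofReal N ≤ ENNReal.ofReal (A * (T - t) ^ (-(1 / 2 : ℝ))) :=
        ENNReal.ofReal_le_ofReal h1
    _ ≤ ∫⁻ x, ENNReal.ofReal (frobeniusNormSq (fderiv ℝ (u t) x)) := hfloor t htI
    _ ≤ ∫⁻ x, ‖curl (u t) x‖ₑ ^ 2 := hcurl t htI

end BlowupEnstrophyUnbounded

open BlowupEnstrophyUnbounded in
/-- **Item stmt-NavierStokesRegularity-22867** (`EfficiencyFloor.BlowupEnstrophyUnbounded`): along a
maximal smooth Leray–Hopf rapidly-decaying-datum solution of finite lifespan `T`, the enstrophy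
tends to `+∞` as `t ↑ T` (Leray's floor). A statement about a hypothetical blow-up; nothing about
NS regularity is asserted. [folklore] -/
theorem efficiencyFloor_blowupEnstrophyUnbounded_proof :
    Summit.NavierStokesRegularity.NavierStokesRegularity.Theses.EfficiencyFloor.BlowupEnstrophyUnbounded := by
  unfold Summit.NavierStokesRegularity.NavierStokesRegularity.Theses.EfficiencyFloor.BlowupEnstrophyUnbounded
  intro ν T hν hT u p hmax hLH hdec N
  exact main hν hT hmax hLH hdec N

end Summit.NavierStokesRegularity.NavierStokesRegularity.Theorems

end
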